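import Literature.MathematicalPhysics.QuantumManyBody.PeriodicFeynmanKacTrialState
import Mathlib.Analysis.Calculus.BumpFunction.Convolution
import HarnessLib

/-!
# Route BECCutLineWeakDisorder — `WitnessTransfer`: trial states from a truncated witness

Support file (does not close the item) for item stmt-AtomisticToContinuum-14978
(`Summit.AtomisticToContinuum.BoseEinsteinCondensation.Theses.BECCutLineWeakDisorder.WitnessTransfer`),
stub `stub_trialState` (E1b) of line Sketch. A bounded measurable symmetric `f ≥ 0` supported
with a margin `r₀` inside a set `S ⊆ Λ_L^N` on which `V = interaction v` is integrable is
turned into genuine Dirichlet trial states `c · (ρ_r ⋆ f)` (`ρ_r` the library's symmetric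
product mollifier `mollifier`, `0 < r < r₁`) with energy `≤ c² (K + ∫ f² V + ε)`, `K` an
eventual bound of the free small-time form `sqIncr t f / (2t)`. Ingredients: the kernel bound
`ρ_r ≤ 2^{3N} / vol(B̄(X, r))` and the Lebesgue differentiation theorem (Besicovitch covering of
the sup-balls, Mathlib's `VitaliFamily.ae_tendsto_average_norm_sub` and
`tendsto_integral_smul_of_tendsto_average_norm_sub`, as in Mathlib's
`ContDiffBump.ae_convolution_tendsto_right_of_locallyIntegrable`) give `ρ_r ⋆ f → f` a.e. as
`r → 0⁺` (`ae_tendsto_mollify_config`); dominated convergence then gives the convergence of the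
potential energies and norms (`tendsto_lintegral_sq_mul_interaction_mollify`,
`tendsto_integral_sq_mollify`); the kinetic energy is bounded by Fatou and `sqIncr_conv_le`
(`lintegral_realKinetic_mollify_le`, as in the library's `lintegral_realKinetic_trialFn_le`).

## References

* K. L. Chung, Z. Zhao, *From Brownian Motion to Schrödinger's Equation* (1995), Thm 3.27 and
  Prop 3.29 (81) with its proof (density of `C_c^∞(D)` in the form domain). [ChungZhao1995]
* E. H. Lieb, R. Seiringer, J. P. Solovej, J. Yngvason (2005), §1.2 (1.16)–(1.17). [LSSY2005]
-/

noncomputable section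

open MeasureTheory Filter Set Metric
open scoped ENNReal NNReal Topology

namespace Summit.AtomisticToContinuum.BoseEinsteinCondensation.Theorems.CutLineWitness

open Literature.MathematicalPhysics.QuantumManyBody.BoseGas

variable {N : ℕ}

/-- **Sup bound of the product mollifier against the volume of sup-balls**:
`ρ_r(Y) ≤ (2^{dim ℝ³})^N / vol(B̄(X, r))` for every centre `X` (each factor is a normalised bump
of inner radius `r/2` and outer radius `r`, bounded by `2^{dim} / vol(B̄(Xᵢ, r))`; the sup-ball
is the product of the one-particle balls). [folklore] -/
theorem mollifier_le_pow_div_measureReal_closedBall {r : ℝ} (hr : 0 < r) (X Y : Config N) :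
    mollifier hr Y ≤ ((2 : ℝ) ^ Module.finrank ℝ Space) ^ N / volume.real (closedBall X r) := by
  have h1 : ∀ i, (bumpOne hr).normed volume (Y i) ≤
      (2 : ℝ) ^ Module.finrank ℝ Space / volume.real (closedBall (X i) r) := by
    intro i
    have h := (bumpOne hr).normed_le_div_measure_closedBall_rOut (μ := volume) 2
      (by show r ≤ 2 * (r / 2); linarith) (Y i)
    have hrOut : (bumpOne hr).rOut = r := rfl
    rwa [hrOut, ← Measure.addHaar_real_closedBall_center volume (X i) r] at h
  have hvol : volume.real (closedBall X r) = ∏ i, volume.real (closedBall (X i) r) := by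
    rw [measureReal_def, volume_pi_closedBall X hr.le, ENNReal.toReal_prod]
    rfl
  calc mollifier hr Y = ∏ i, (bumpOne hr).normed volume (Y i) := rfl
    _ ≤ ∏ i, ((2 : ℝ) ^ Module.finrank ℝ Space / volume.real (closedBall (X i) r)) :=
        Finset.prod_le_prod (fun i _ => (bumpOne hr).nonneg_normed _) fun i _ => h1 i
    _ = (∏ _i : Fin N, (2 : ℝ) ^ Module.finrank ℝ Space) / ∏ i, volume.real (closedBall (X i) r) :=
        Finset.prod_div_distrib _ _
    _ = ((2 : ℝ) ^ Module.finrank ℝ Space) ^ N / volume.real (closedBall X r) := by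
        rw [Finset.prod_const, Finset.card_univ, Fintype.card_fin, hvol]

/-- **Mollification by the product mollifier converges almost everywhere**: for a locally
integrable `f` on `(ℝ³)^N`, `(ρ_r ⋆ f)(X) → f(X)` as `r → 0⁺` for a.e. `X` (Lebesgue
differentiation along the sup-balls, which have the Besicovitch property, and the kernel bound
`mollifier_le_pow_div_measureReal_closedBall`). Stated for any family `G r = ρ_r ⋆ f` (`r > 0`).
[folklore] -/
theorem ae_tendsto_mollify_config {f : Config N → ℝ} (hf : LocallyIntegrable f volume)
    {G : ℝ → Config N → ℝ} (hG : ∀ (r : ℝ) (hr : 0 < r), G r = mollify hr f) :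
    ∀ᵐ X ∂(volume : Measure (Config N)), Tendsto (fun r : ℝ => G r X) (𝓝[>] 0) (𝓝 (f X)) := by
  haveI : (volume : Measure (Config N)).IsNegInvariant := by
    refine ⟨?_⟩
    have h := Measure.map_addHaar_smul (volume : Measure (Config N)) (r := (-1 : ℝ)) (by norm_num)
    have hneg : (fun x : Config N => (-1 : ℝ) • x) = Neg.neg := by funext x; simp
    rw [hneg] at h
    rw [Measure.neg, h]
    simp
  filter_upwards [(Besicovitch.vitaliFamily (volume : Measure (Config N))).ae_tendsto_average_norm_sub hf]
    with X hX
  have havg : Tendsto (fun r : ℝ => ⨍ y in closedBall X r, ‖f y - f X‖ ∂volume) (𝓝[>] 0) (𝓝 0) :=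
    hX.comp (Besicovitch.tendsto_filterAt volume X)
  -- the kernels `g r y = ρ_r (X - y)` (zero for `r ≤ 0`)
  set g : ℝ → Config N → ℝ := fun r y => if h : 0 < r then mollifier h (X - y) else 0 with hg
  have f_int : ∀ᶠ r : ℝ in 𝓝[>] 0, IntegrableOn f (closedBall X r) volume :=
    Eventually.of_forall fun r => hf.integrableOn_isCompact (isCompact_closedBall _ _)
  have g_int : Tendsto (fun r => ∫ y, g r y) (𝓝[>] (0 : ℝ)) (𝓝 1) := by
    refine tendsto_const_nhds.congr' ?_
    filter_upwards [self_mem_nhdsWithin] with r hr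
    have hr' : (0 : ℝ) < r := hr
    simp only [hg, dif_pos hr']
    rw [integral_sub_left_eq_self (fun Y => mollifier hr' Y) volume X, integral_mollifier]
  have g_supp : ∀ᶠ r : ℝ in 𝓝[>] 0, Function.support (g r) ⊆ closedBall X r := by
    filter_upwards [self_mem_nhdsWithin] with r hr
    have hr' : (0 : ℝ) < r := hr
    intro y hy
    simp only [hg, dif_pos hr', Function.mem_support] at hy
    rw [mem_closedBall, dist_comm, dist_eq_norm]
    exact (norm_lt_of_mollifier_ne_zero hr' hy).le
  have g_bound : ∀ᶠ r : ℝ in 𝓝[>] 0, ∀ y,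
      |g r y| ≤ ((2 : ℝ) ^ Module.finrank ℝ Space) ^ N / volume.real (closedBall X r) := by
    filter_upwards [self_mem_nhdsWithin] with r hr
    have hr' : (0 : ℝ) < r := hr
    intro y
    simp only [hg, dif_pos hr']
    rw [abs_of_nonneg (mollifier_nonneg hr' _)]
    exact mollifier_le_pow_div_measureReal_closedBall hr' X (X - y)
  refine (tendsto_integral_smul_of_tendsto_average_norm_sub _ havg f_int g_int g_supp
    g_bound).congr' ?_
  filter_upwards [self_mem_nhdsWithin] with r hr
  have hr' : (0 : ℝ) < r := hr
  simp only [hg, dif_pos hr', smul_eq_mul]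
  -- `∫ ρ_r(X - y) f(y) dy = (ρ_r ⋆ f)(X)` by the reflection `y ↦ X - y`
  have h : (fun y => mollifier hr' (X - y) * f y) =
      fun y => (fun Y => mollifier hr' Y * f (X - Y)) (X - y) := by
    funext y; simp only [sub_sub_cancel]
  rw [hG r hr', h, integral_sub_left_eq_self (fun Y => mollifier hr' Y * f (X - Y)) volume X]
  rfl

/-- **Support of the mollification of a function supported with a margin**: if
`B̄(X, r₀) ⊆ S` whenever `f X ≠ 0`, then for `r ≤ r₀` the mollification `ρ_r ⋆ f` vanishes off
`S`. [folklore] -/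
theorem mem_of_mollify_ne_zero {f : Config N → ℝ} {S : Set (Config N)} {r₀ : ℝ}
    (hmargin : ∀ X, f X ≠ 0 → closedBall X r₀ ⊆ S) {r : ℝ} (hr : 0 < r) (hrr₀ : r ≤ r₀)
    {X : Config N} (hX : mollify hr f X ≠ 0) : X ∈ S := by
  by_contra hXS
  refine hX (mollify_eq_zero hr fun Y hY => ?_)
  by_contra hne
  refine hXS (hmargin _ hne (mem_closedBall.2 ?_))
  rw [dist_eq_norm, sub_sub_cancel]
  exact (hY.trans_le hrr₀).le

/-- **The kinetic energy of the mollification is controlled by the free small-time form**: if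
eventually `sqIncr t f / (2t) ≤ K'` as `t → 0⁺` for a bounded measurable `f`, then
`∫ |∇(ρ_r ⋆ f)|² ≤ K'` (Fatou lower bound for the `C¹` mollification and mollification
monotonicity of `sqIncr`). [cite: ChungZhao1995, Prop 3.29 (81)] -/
theorem lintegral_realKinetic_mollify_le {f : Config N → ℝ} (hfm : Measurable f) {M : ℝ}
    (hM : ∀ X, |f X| ≤ M) (hli : LocallyIntegrable f volume) {r : ℝ} (hr : 0 < r) {K' : ℝ}
    (hev : ∀ᶠ t : ℝ≥0 in 𝓝[>] 0, (ENNReal.ofReal (2 * t))⁻¹ * sqIncr t f ≤ ENNReal.ofReal K') :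
    ∫⁻ X, realKinetic (mollify hr f) X ≤ ENNReal.ofReal K' := by
  refine (kinetic_le_liminf_sqIncr (contDiff_mollify hr hli)).trans ?_
  have hbound : ∀ᶠ t : ℝ≥0 in 𝓝[>] 0,
      (ENNReal.ofReal (2 * t))⁻¹ * sqIncr t (mollify hr f) ≤ ENNReal.ofReal K' := by
    filter_upwards [hev] with t ht
    have h1 : sqIncr t (mollify hr f) ≤ sqIncr t f := by
      have hrepr : mollify hr f = fun x => ∫ y, f (x - y) ∂mollifierMeasure hr := by
        funext x; exact mollify_eq_integral_measure hr f x
      rw [hrepr]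
      exact sqIncr_conv_le hfm hM _ t
    exact (mul_le_mul' le_rfl h1).trans ht
  calc liminf (fun t : ℝ≥0 => (ENNReal.ofReal (2 * t))⁻¹ * sqIncr t (mollify hr f)) (𝓝[>] 0)
      ≤ liminf (fun _ : ℝ≥0 => ENNReal.ofReal K') (𝓝[>] 0) := liminf_le_liminf hbound
    _ = ENNReal.ofReal K' := liminf_const _

/-- **The potential energy of the mollifications converges**: for a bounded measurable `f`
supported with margin `r₀ > 0` inside a measurable `S` with `∫_S V < ∞`,
`∫ (ρ_r ⋆ f)² V → ∫ f² V` as `r → 0⁺` (dominated convergence with the bound `M² · 1_S · V`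
and the a.e. convergence `ae_tendsto_mollify_config`; off `S` everything vanishes, and on `S`
the potential is a.e. finite). [folklore] -/
theorem tendsto_lintegral_sq_mul_interaction_mollify {v : ℝ → ℝ≥0∞} (hv : Measurable v)
    {f : Config N → ℝ} {M : ℝ} (hM : ∀ X, |f X| ≤ M) (hli : LocallyIntegrable f volume)
    {S : Set (Config N)} (hSm : MeasurableSet S) {r₀ : ℝ} (hr₀ : 0 < r₀)
    (hmargin : ∀ X, f X ≠ 0 → closedBall X r₀ ⊆ S) (hSV : ∫⁻ X in S, interaction v X ≠ ⊤)
    {G : ℝ → Config N → ℝ} (hG : ∀ (r : ℝ) (hr : 0 < r), G r = mollify hr f) :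
    Tendsto (fun r => ∫⁻ X, ENNReal.ofReal (G r X ^ 2) * interaction v X) (𝓝[>] 0)
      (𝓝 (∫⁻ X, ENNReal.ofReal (f X ^ 2) * interaction v X)) := by
  have hfS : ∀ X, X ∉ S → f X = 0 := fun X hX =>
    by_contra fun h => hX (hmargin X h (mem_closedBall_self hr₀.le))
  have hr₀mem : ∀ᶠ r : ℝ in 𝓝[>] 0, 0 < r ∧ r ≤ r₀ := by
    filter_upwards [Ioo_mem_nhdsGT hr₀] with r hr
    exact ⟨hr.1, hr.2.le⟩
  have hGS : ∀ {r : ℝ} (_ : 0 < r ∧ r ≤ r₀) {X : Config N}, X ∉ S → G r X = 0 := by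
    intro r hr X hXS
    rw [hG r hr.1]
    by_contra h
    exact hXS (mem_of_mollify_ne_zero hmargin hr.1 hr.2 h)
  refine tendsto_lintegral_filter_of_dominated_convergence
    (fun X => ENNReal.ofReal (M ^ 2) * S.indicator (interaction v) X) ?_ ?_ ?_ ?_
  · filter_upwards [hr₀mem] with r hr
    rw [hG r hr.1]
    exact (ENNReal.measurable_ofReal.comp
      ((contDiff_mollify hr.1 hli).continuous.measurable.pow_const 2)).mul
      (measurable_interaction hv)
  · filter_upwards [hr₀mem] with r hr
    refine Eventually.of_forall fun X => ?_
    by_cases hXS : X ∈ S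
    · rw [indicator_of_mem hXS]
      refine mul_le_mul' (ENNReal.ofReal_le_ofReal ?_) le_rfl
      rw [hG r hr.1, ← sq_abs]
      exact pow_le_pow_left₀ (abs_nonneg _) (abs_mollify_le hr.1 hM X) 2
    · rw [hGS hr hXS]
      simp
  · rw [lintegral_const_mul' _ _ ENNReal.ofReal_ne_top, lintegral_indicator hSm]
    exact ENNReal.mul_ne_top ENNReal.ofReal_ne_top hSV
  · have hVae : ∀ᵐ X ∂(volume : Measure (Config N)), X ∈ S → interaction v X < ⊤ := by
      have := ae_lt_top' (μ := volume.restrict S) (measurable_interaction hv).aemeasurable hSV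
      rwa [ae_restrict_iff' hSm] at this
    filter_upwards [ae_tendsto_mollify_config hli hG, hVae] with X hX hXV
    by_cases hXS : X ∈ S
    · exact ENNReal.Tendsto.mul_const (ENNReal.tendsto_ofReal (hX.pow 2))
        (Or.inr (hXV hXS).ne)
    · have hlim : ENNReal.ofReal (f X ^ 2) * interaction v X = 0 := by
        rw [hfS X hXS]; simp
      rw [hlim]
      refine tendsto_const_nhds.congr' ?_
      filter_upwards [hr₀mem] with r hr
      rw [hGS hr hXS]
      simp

/-- **The norms of the mollifications converge**: for a bounded measurable `f` supported with
margin `r₀ > 0` inside a measurable `S` of finite measure, `∫ (ρ_r ⋆ f)² → ∫ f²` as `r → 0⁺`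
(dominated convergence with the bound `M² · 1_S` and `ae_tendsto_mollify_config`). [folklore] -/
theorem tendsto_integral_sq_mollify {f : Config N → ℝ} {M : ℝ} (hM : ∀ X, |f X| ≤ M)
    (hli : LocallyIntegrable f volume) {S : Set (Config N)} (hSm : MeasurableSet S)
    (hSfin : volume S ≠ ⊤) {r₀ : ℝ} (hr₀ : 0 < r₀) (hmargin : ∀ X, f X ≠ 0 → closedBall X r₀ ⊆ S)
    {G : ℝ → Config N → ℝ} (hG : ∀ (r : ℝ) (hr : 0 < r), G r = mollify hr f) :
    Tendsto (fun r => ∫ X, G r X ^ 2) (𝓝[>] 0) (𝓝 (∫ X, f X ^ 2)) := by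
  have hr₀mem : ∀ᶠ r : ℝ in 𝓝[>] 0, 0 < r ∧ r ≤ r₀ := by
    filter_upwards [Ioo_mem_nhdsGT hr₀] with r hr
    exact ⟨hr.1, hr.2.le⟩
  refine tendsto_integral_filter_of_dominated_convergence (S.indicator fun _ => M ^ 2) ?_ ?_ ?_ ?_
  · filter_upwards [hr₀mem] with r hr
    rw [hG r hr.1]
    exact ((contDiff_mollify hr.1 hli).continuous.measurable.pow_const 2).aestronglyMeasurable
  · filter_upwards [hr₀mem] with r hr
    refine Eventually.of_forall fun X => ?_
    rw [Real.norm_eq_abs, abs_pow, hG r hr.1]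
    by_cases hXS : X ∈ S
    · rw [indicator_of_mem hXS]
      exact pow_le_pow_left₀ (abs_nonneg _) (abs_mollify_le hr.1 hM X) 2
    · have h0 : mollify hr.1 f X = 0 := by
        by_contra h
        exact hXS (mem_of_mollify_ne_zero hmargin hr.1 hr.2 h)
      rw [indicator_of_notMem hXS, h0]
      simp
  · exact (integrableOn_const hSfin).integrable_indicator hSm
  · filter_upwards [ae_tendsto_mollify_config hli hG] with X hX
    exact hX.pow 2

/-- **Trial states from a truncated witness (stub `stub_trialState`, E1b of line Sketch).** For
`f` bounded, measurable, symmetric, with `∫ f² > 0`, supported with a margin `r₀ > 0` inside a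
measurable `S ⊆ Λ_L^N` with `∫_S V < ∞`, and with free small-time form eventually `≤ K + ε'`
for every `ε' > 0`: for every `ε > 0` there is `r₁ > 0` such that for all `0 < r < r₁` the
normalised mollification `Φ = c · (ρ_r ⋆ f)` (`c = ‖ρ_r ⋆ f‖₂⁻¹`, `c² ∫ f² ≤ 1 + ε`) is a
bosonic Dirichlet trial state with `𝓔[Φ] ≤ c² (K + ∫ f² V + ε)` (the mollification is `C¹`,
symmetric, supported in `S`; kinetic energy by `lintegral_realKinetic_mollify_le`, potential
energy and norm by `tendsto_lintegral_sq_mul_interaction_mollify`, `tendsto_integral_sq_mollify`)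
— the density step of Chung–Zhao's Prop 3.29 for a discontinuous form-bounded function.
[cite: ChungZhao1995, Thm 3.27 and Prop 3.29 (81)] -/
theorem stub_trialState {N : ℕ} {v : ℝ → ℝ≥0∞} (hv : Measurable v) {L : ℝ} (hL : 0 < L)
    {f : Config N → ℝ} (hfm : Measurable f) {M : ℝ} (hM : ∀ X, |f X| ≤ M) (hnn : ∀ X, 0 ≤ f X)
    (hsymm : ∀ (σ : Equiv.Perm (Fin N)) (X : Config N), f (X ∘ σ) = f X)
    (hpos : 0 < ∫ X, f X ^ 2)
    {S : Set (Config N)} (hSm : MeasurableSet S) (hSbox : S ⊆ boxN N L) {r₀ : ℝ} (hr₀ : 0 < r₀)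
    (hmargin : ∀ X, f X ≠ 0 → Metric.closedBall X r₀ ⊆ S)
    (hSV : ∫⁻ X in S, interaction v X ≠ ⊤)
    {K : ℝ} (hK : 0 ≤ K)
    (hev : ∀ ε : ℝ, 0 < ε → ∀ᶠ t : ℝ≥0 in 𝓝[>] 0,
      (ENNReal.ofReal (2 * t))⁻¹ * sqIncr t f ≤ ENNReal.ofReal (K + ε))
    {ε : ℝ} (hε : 0 < ε) :
    ∃ r₁ : ℝ, 0 < r₁ ∧ ∀ (r : ℝ) (hr : 0 < r), r < r₁ → ∃ (c : ℝ) (Φ : TrialState N L),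
      0 < c ∧ c ^ 2 * ∫ X, f X ^ 2 ≤ 1 + ε ∧
      (Φ.ψ = fun X => (((c * mollify hr f X : ℝ)) : ℂ)) ∧
      energy v Φ ≤ ENNReal.ofReal (c ^ 2) *
        (ENNReal.ofReal K + (∫⁻ X, ENNReal.ofReal (f X ^ 2) * interaction v X) +
          ENNReal.ofReal ε) := by
  have _ := hL -- redundant hypotheses of the registered signature (`S ⊆ Λ_L^N` and the
  have _ := hnn -- margin are all that is used of the box; positivity of `f` is not needed)
  have hli : LocallyIntegrable f volume :=
    (locallyIntegrable_const M).mono hfm.aestronglyMeasurable (Eventually.of_forall fun X => by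
      rw [Real.norm_eq_abs, Real.norm_eq_abs]; exact (hM X).trans (le_abs_self M))
  -- the family of mollifications, extended by `f` for `r ≤ 0`
  set G : ℝ → Config N → ℝ := fun r => if h : 0 < r then mollify h f else f with hGdef
  have hG : ∀ (r : ℝ) (hr : 0 < r), G r = mollify hr f := fun r hr => by
    simp only [hGdef, dif_pos hr]
  have hSfin : volume S ≠ ⊤ := ((measure_mono hSbox).trans_lt (volume_boxN_lt_top N L)).ne
  have hε2 : 0 < ε / 2 := half_pos hε
  have hfS : ∀ X, X ∉ S → f X = 0 := fun X hX =>
    by_contra fun h => hX (hmargin X h (mem_closedBall_self hr₀.le))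
  -- the potential energy of `f` is finite
  set P0 : ℝ≥0∞ := ∫⁻ X, ENNReal.ofReal (f X ^ 2) * interaction v X with hP0
  have hP0top : P0 ≠ ⊤ := by
    have hb : ENNReal.ofReal (M ^ 2) * ∫⁻ X in S, interaction v X ≠ ⊤ :=
      ENNReal.mul_ne_top ENNReal.ofReal_ne_top hSV
    refine ne_top_of_le_ne_top hb ?_
    rw [← lintegral_indicator hSm, ← lintegral_const_mul' _ _ ENNReal.ofReal_ne_top]
    refine lintegral_mono fun X => ?_
    by_cases hXS : X ∈ S
    · rw [indicator_of_mem hXS]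
      refine mul_le_mul' (ENNReal.ofReal_le_ofReal ?_) le_rfl
      rw [← sq_abs]
      exact pow_le_pow_left₀ (abs_nonneg _) (hM X) 2
    · rw [hfS X hXS]
      simp
  -- eventualities as `r → 0⁺`: potential energy, norm, margin
  have hP : ∀ᶠ r : ℝ in 𝓝[>] 0,
      ∫⁻ X, ENNReal.ofReal (G r X ^ 2) * interaction v X < P0 + ENNReal.ofReal (ε / 2) :=
    (tendsto_order.1 (tendsto_lintegral_sq_mul_interaction_mollify hv hM hli hSm hr₀ hmargin
      hSV hG)).2 _ (ENNReal.lt_add_right hP0top (ENNReal.ofReal_pos.2 hε2).ne')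
  set n0 : ℝ := ∫ X, f X ^ 2 with hn0
  have hε1 : (0 : ℝ) < 1 + ε := by linarith
  have hn0lt : n0 / (1 + ε) < n0 := div_lt_self hpos (by linarith)
  have hn : ∀ᶠ r : ℝ in 𝓝[>] 0, n0 / (1 + ε) < ∫ X, G r X ^ 2 :=
    (tendsto_order.1 (tendsto_integral_sq_mollify hM hli hSm hSfin hr₀ hmargin hG)).1 _ hn0lt
  obtain ⟨r₁, hr₁pos, hr₁⟩ :=
    (nhdsGT_basis (0 : ℝ)).eventually_iff.1 ((hP.and hn).and (Ioo_mem_nhdsGT hr₀))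
  refine ⟨r₁, hr₁pos, fun r hr hrr₁ => ?_⟩
  obtain ⟨⟨hPr, hnr⟩, hrr₀⟩ := hr₁ ⟨hr, hrr₁⟩
  rw [hG r hr] at hPr hnr
  -- the mollification at this `r`
  set φ := mollify hr f with hφdef
  have hφC : ContDiff ℝ 1 φ := contDiff_mollify hr hli
  have hφ0S : ∀ X, X ∉ S → φ X = 0 := fun X hX =>
    by_contra fun h => hX (mem_of_mollify_ne_zero hmargin hr hrr₀.2.le h)
  have hφ0 : ∀ X, X ∉ boxN N L → φ X = 0 := fun X hX => hφ0S X fun h => hX (hSbox h)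
  have hcs : HasCompactSupport φ :=
    HasCompactSupport.intro (isCompact_closedBall (0 : Config N) (3 * |L|))
      fun X hX => hφ0 X fun hb => hX (boxN_subset_closedBall N L hb)
  have hφsq : Integrable (fun X => φ X ^ 2) volume :=
    (hφC.continuous.memLp_of_hasCompactSupport hcs).integrable_sq
  -- the normalisation
  set n : ℝ := ∫ X, φ X ^ 2 with hndef
  have hnpos : 0 < n := lt_trans (div_pos hpos hε1) hnr
  set c : ℝ := (Real.sqrt n)⁻¹ with hc
  have hcpos : 0 < c := inv_pos.2 (Real.sqrt_pos.2 hnpos)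
  have hc2 : c ^ 2 = n⁻¹ := by rw [hc, inv_pow, Real.sq_sqrt hnpos.le]
  have hc2le : c ^ 2 * n0 ≤ 1 + ε := by
    rw [hc2, inv_mul_le_iff₀ hnpos]
    have := (div_lt_iff₀ hε1).1 hnr
    linarith
  have hsqX : ∀ X, ((‖((c * φ X : ℝ) : ℂ)‖₊ : ℝ≥0∞)) ^ 2 =
      ENNReal.ofReal (c ^ 2) * ENNReal.ofReal (φ X ^ 2) := fun X => by
    rw [ennnorm_sq_ofReal_periodic, mul_pow, ENNReal.ofReal_mul (sq_nonneg _)]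
  have hnormΨ : ∫⁻ X, ((‖((c * φ X : ℝ) : ℂ)‖₊ : ℝ≥0∞)) ^ 2 = 1 := by
    simp_rw [hsqX]
    rw [lintegral_const_mul' _ _ ENNReal.ofReal_ne_top,
      ← ofReal_integral_eq_lintegral_ofReal hφsq (Eventually.of_forall fun X => sq_nonneg _),
      ← ENNReal.ofReal_mul (sq_nonneg _), hc2, inv_mul_cancel₀ hnpos.ne', ENNReal.ofReal_one]
  -- the trial state
  let Ψ : TrialState N L :=
    { ψ := fun X => (((c * φ X : ℝ)) : ℂ)
      contDiff := Complex.ofRealCLM.contDiff.comp (contDiff_const.mul hφC)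
      eq_zero := fun X hX => by simp [hφ0 X hX]
      symm := fun σ X => by
        show (((c * φ (X ∘ σ) : ℝ)) : ℂ) = (((c * φ X : ℝ)) : ℂ)
        rw [hφdef, mollify_comp_perm hr hsymm σ X]
      norm_eq := hnormΨ }
  -- the kinetic bound
  have hkin : ∫⁻ X, realKinetic φ X ≤ ENNReal.ofReal (K + ε / 2) :=
    lintegral_realKinetic_mollify_le hfm hM hli hr (hev (ε / 2) hε2)
  -- the energy of the real-scaled state: `𝓔[Ψ] = c² (∫|∇φ|² + ∫ φ² V)`
  have hE : energy v Ψ = ENNReal.ofReal (c ^ 2) *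
      ((∫⁻ X, realKinetic φ X) + ∫⁻ X, ENNReal.ofReal (φ X ^ 2) * interaction v X) := by
    have hφd : Differentiable ℝ φ := hφC.differentiable one_ne_zero
    have hcφd : Differentiable ℝ fun Y => c * φ Y := (differentiable_const c).mul hφd
    have hkinX : ∀ X, kineticDensity Ψ.ψ X = ENNReal.ofReal (c ^ 2) * realKinetic φ X := by
      intro X
      show kineticDensity (fun Y => (((c * φ Y : ℝ)) : ℂ)) X = _
      rw [kineticDensity_ofReal hcφd, realKinetic_const_mul_periodic hφd]
    have hnormX : ∀ X, ((‖Ψ.ψ X‖₊ : ℝ≥0∞)) ^ 2 =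
        ENNReal.ofReal (c ^ 2) * ENNReal.ofReal (φ X ^ 2) := fun X => hsqX X
    unfold energy
    simp_rw [hkinX, hnormX]
    have h1 : ∀ X, ENNReal.ofReal (c ^ 2) * realKinetic φ X +
        interaction v X * (ENNReal.ofReal (c ^ 2) * ENNReal.ofReal (φ X ^ 2)) =
        ENNReal.ofReal (c ^ 2) * (realKinetic φ X + ENNReal.ofReal (φ X ^ 2) * interaction v X) := by
      intro X; ring
    simp_rw [h1]
    rw [lintegral_const_mul' _ _ ENNReal.ofReal_ne_top,
      lintegral_add_left (measurable_realKinetic hφC)]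
  refine ⟨c, Ψ, hcpos, hc2le, rfl, ?_⟩
  rw [hE]
  refine mul_le_mul' le_rfl ?_
  calc (∫⁻ X, realKinetic φ X) + ∫⁻ X, ENNReal.ofReal (φ X ^ 2) * interaction v X
      ≤ ENNReal.ofReal (K + ε / 2) + (P0 + ENNReal.ofReal (ε / 2)) := add_le_add hkin hPr.le
    _ = ENNReal.ofReal K + P0 + ENNReal.ofReal ε := by
        rw [ENNReal.ofReal_add hK hε2.le]
        have h2 : ENNReal.ofReal ε = ENNReal.ofReal (ε / 2) + ENNReal.ofReal (ε / 2) := by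
          rw [← ENNReal.ofReal_add hε2.le hε2.le, add_halves]
        rw [h2]
        ring

end Summit.AtomisticToContinuum.BoseEinsteinCondensation.Theorems.CutLineWitness
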